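import Literature.AlgebraicGeometry.Resolution.PrincipalRidgeHasseCoefficients
import Mathlib.Data.Nat.Choose.Lucas
import HarnessLib

/-!
# Homogeneous additive polynomials are `p`-polynomials `Σ c_i X_i^{p^e}` (Schober 2021, Rem. 2.6; BHM 2010, Def. 1.2):
# the structure of forms whose intermediate Hasse–Schmidt derivatives vanish

Topic: `Literature/AlgebraicGeometry/Resolution`. Sequel of `Ridge.lean` (additive polynomials, `IsAdditive`) and
`HasseSchmidtDerivatives.lean` (`hasseDeriv`). `Ridge.lean` proves that the `p`-polynomials `Σ_j c_j X_j^{q}`,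
`q = p^e`, are additive (`isAdditive_of_mem_span_X_pow`) and records the converse as prose:

> **Schober 2021, Rem. 2.6.** "If `p = char(K) > 0` … the additive homogeneous polynomials are of the form
> `φ = Σ λ_i W_i^q`, for `λ_i ∈ K` and `q = p^e`, `e ∈ ℤ_{≥0}`. In the case `char(K) = 0` the additive polynomials are
> those homogeneous of degree one."
> **BHM 2010, Def. 1.2.** "additive polynomials, i.e. polynomials `P` such that `P(X + X') = P(X) + P(X')` … of the form
> `Σ λ_i X_i^{p^{r_i}}`; homogeneous ones have a single exponent."

This file PROVES the converse, in the sharper form used by Giraud's structure theorem for the ridge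
(`RidgeIdealAdditive.lean`): over a field `K` of exponential characteristic `p`, a NONZERO FORM `g` OF DEGREE `d ≥ 1`
ALL OF WHOSE HASSE–SCHMIDT DERIVATIVES `D_A g` WITH `0 < |A| < d` VANISH is `Σ_i c_i X_i^{p^e}` with `d = p^e`
(`exists_eq_sum_C_mul_X_pow_of_hasseDeriv_eq_zero`). Steps: the closed formula
`coeff_β(D_A g) = (∏ binom((A+β)_i, A_i)) coeff_{A+β}(g)` (`coeff_hasseDeriv`); a monomial `x^B` of `g` with two
variables or with `0 < B_i < d` is detected by `D_{B_i e_i} g ≠ 0` (`eq_single_of_mem_support`); `x_i^d` with `d` not a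
power of `p` is detected by `D_{a e_i} g = binom(d, a) x_i^{d−a} ≠ 0` for the Kummer–Lucas exponent `a`
(`exists_pow_eq_of_hasseDeriv_eq_zero`, via Mathlib's `Choose.eq_pow_multiplicity_of_choose_modEq_zero_nat`). For an
ADDITIVE form the hypothesis holds (`IsAdditive.hasseDeriv_eq_C`: `f(x + u) = f(x) + f(u)` says `D_A f = coeff_A(f)`
for `A ≠ 0`), whence Schober's remark `IsAdditive.exists_eq_sum_C_mul_X_pow`.

Written for the cell res-hironaka (seat res-L1-s46-pv-7, W4.6 rung (iv)). AI-written; AI review is weaker than expert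
review.

## References

* B. Schober, *Idealistic exponents: tangent cone, ridge, characteristic polyhedra*, J. Algebra 565 (2021), Def. 2.5,
  Rem. 2.6. [Schober2021IdealisticExponents]
* J. Berthomieu, P. Hivert, H. Mourtada, *Computing Hironaka's invariants: ridge and directrix*, Contemp. Math. 521
  (2010), Def. 1.2, §2.1. [BerthomieuHivertMourtada2010]
* A. Grothendieck, EGA IV₄, Thm. 16.11.2. [EGAIV4]
-/

noncomputable section

open MvPolynomial

namespace Literature.AlgebraicGeometry.Resolution

universe u

/-! ## 1. Coefficients of Hasse–Schmidt derivatives -/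

section HasseVanishing

variable {σ : Type*} [DecidableEq σ] {R : Type*} [CommRing R]

/-- **Closed formula `coeff_β(D^{(α)} g) = (∏_{i ∈ supp α} binom(α_i + β_i, α_i)) · coeff_{α+β}(g)`.**
[cite: EGAIV4, Thm. 16.11.2 (16.11.2.1)] -/
theorem coeff_hasseDeriv (α β : σ →₀ ℕ) (g : MvPolynomial σ R) :
    coeff β (hasseDeriv R α g) = ((∏ i ∈ α.support, ((α + β) i).choose (α i) : ℕ) : R) * coeff (α + β) g := by
  conv_lhs => rw [g.as_sum, map_sum, coeff_sum]
  simp_rw [coeff_hasseDeriv_monomial]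
  rw [Finset.sum_ite_eq']
  split_ifs with h
  · rfl
  · rw [notMem_support_iff.mp h, mul_zero]

/-- The diagonal case: `coeff_{B − A}(D^{(A)} g) = (∏ binom(B_i, A_i)) coeff_B(g)` for `A ≤ B`.
[cite: EGAIV4, Thm. 16.11.2 (16.11.2.1)] -/
theorem coeff_sub_hasseDeriv {A B : σ →₀ ℕ} (h : A ≤ B) (g : MvPolynomial σ R) :
    coeff (B - A) (hasseDeriv R A g) = ((∏ i ∈ A.support, (B i).choose (A i) : ℕ) : R) * coeff B g := by
  rw [coeff_hasseDeriv, add_tsub_cancel_of_le h]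

/-- `x_i^{B_i}`-extraction: `coeff_{B − B_i e_i}(D^{(B_i e_i)} g) = coeff_B(g)` (the binomial `binom(B_i, B_i) = 1`).
[cite: EGAIV4, Thm. 16.11.2 (16.11.2.1)] -/
theorem coeff_sub_hasseDeriv_single_self (B : σ →₀ ℕ) (i : σ) (g : MvPolynomial σ R) :
    coeff (B - Finsupp.single i (B i)) (hasseDeriv R (Finsupp.single i (B i)) g) = coeff B g := by
  have hle : Finsupp.single i (B i) ≤ B := by
    refine Finsupp.le_def.mpr fun j => ?_
    by_cases hj : j = i
    · subst hj; rw [Finsupp.single_eq_same]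
    · rw [Finsupp.single_eq_of_ne hj]; exact Nat.zero_le _
  rw [coeff_sub_hasseDeriv hle, Finset.prod_eq_one fun j hj => ?_, Nat.cast_one, one_mul]
  have hji : j = i := by
    by_contra hne
    rw [Finsupp.mem_support_iff, Finsupp.single_eq_of_ne hne] at hj
    exact hj rfl
  subst hji
  rw [Finsupp.single_eq_same, Nat.choose_self]

omit [DecidableEq σ] in
/-- An exponent `B` with `|B| = B_i` is the pure power `B_i e_i`. [folklore] -/
private theorem eq_single_of_degree_eq {B : σ →₀ ℕ} {i : σ} (h : B.degree = B i) : B = Finsupp.single i (B i) := by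
  have hsplit : Finsupp.single i (B i) + B.erase i = B := Finsupp.single_add_erase i B
  have hdeg := congrArg Finsupp.degree hsplit
  rw [map_add, Finsupp.degree_single, h] at hdeg
  have h0 : (B.erase i).degree = 0 := by omega
  rw [Finsupp.degree_eq_zero_iff] at h0
  rw [← hsplit, h0, add_zero]
  simp

/-- **A form of degree `d ≥ 1` whose Hasse–Schmidt derivatives `D_A g`, `0 < |A| < d`, all vanish is supported on
the pure powers `x_i^d`**: a monomial `x^B` of `g` with some `0 < B_i < d` would give
`coeff_{B − B_i e_i}(D_{B_i e_i} g) = coeff_B(g) ≠ 0`. [cite: Schober2021IdealisticExponents, Rem. 2.6] -/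
theorem eq_single_of_mem_support {g : MvPolynomial σ R} {d : ℕ} (hg : g.IsHomogeneous d) (hd : 1 ≤ d)
    (hD : ∀ A : σ →₀ ℕ, A ≠ 0 → A.degree < d → hasseDeriv R A g = 0) {B : σ →₀ ℕ} (hB : B ∈ g.support) :
    ∃ i, B = Finsupp.single i d := by
  have hBd : B.degree = d := by
    have := hg (mem_support_iff.mp hB)
    rwa [Finsupp.degree_eq_weight_one]
  have hB0 : B ≠ 0 := by
    rintro rfl
    rw [map_zero] at hBd
    omega
  obtain ⟨i, hi⟩ := Finsupp.support_nonempty_iff.mpr hB0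
  rw [Finsupp.mem_support_iff] at hi
  refine ⟨i, ?_⟩
  by_cases hid : B i = d
  · rw [← hid]
    exact eq_single_of_degree_eq (by rw [hBd, hid])
  · -- `0 < B i < d`: the derivative `D_{B_i e_i}` sees `x^B`
    exfalso
    have hlt : B i < d := by
      have h1 : B i ≤ B.degree := by
        rw [Finsupp.degree_apply]
        exact Finset.single_le_sum (fun j _ => Nat.zero_le (B j)) (Finsupp.mem_support_iff.mpr hi)
      omega
    have hzero := hD (Finsupp.single i (B i)) (by rwa [Ne, Finsupp.single_eq_zero]) (by rwa [Finsupp.degree_single])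
    have h := coeff_sub_hasseDeriv_single_self B i g
    rw [hzero, coeff_zero] at h
    exact (mem_support_iff.mp hB) h.symm

end HasseVanishing

/-! ## 2. The degree is a power of the exponential characteristic -/

section Degree

variable {σ : Type*} [DecidableEq σ] {K : Type*} [Field K]

/-- If `m ≥ 1` is not a power of the exponential characteristic `p` of `K`, some middle binomial coefficient
`binom(m, i)`, `0 < i < m`, is nonzero in `K` (Kummer/Lucas; in characteristic `0`, `binom(m, 1) = m`). [folklore] -/
private theorem exists_choose_natCast_ne_zero_of_ne_pow' (p : ℕ) [ExpChar K p] {m : ℕ} (hm : 0 < m)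
    (h : ∀ j : ℕ, m ≠ p ^ j) : ∃ i, 0 < i ∧ i < m ∧ (m.choose i : K) ≠ 0 := by
  cases ‹ExpChar K p› with
  | zero =>
    have hm1 : m ≠ 1 := fun h1 => h 0 (by rw [pow_zero, h1])
    exact ⟨1, one_pos, by omega, by rw [Nat.choose_one_right]; exact_mod_cast hm.ne'⟩
  | prime hp =>
    haveI : Fact p.Prime := ⟨hp⟩
    by_contra hcon
    push Not at hcon
    refine h (multiplicity p m) (Choose.eq_pow_multiplicity_of_choose_modEq_zero_nat hm fun i hi => ?_)
    rw [Finset.mem_Icc] at hi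
    have h0 : (m.choose i : K) = 0 := hcon i (by omega) (by omega)
    exact Nat.modEq_zero_iff_dvd.mpr ((CharP.cast_eq_zero_iff K p _).mp h0)

/-- **The degree of a nonzero form of degree `d ≥ 1` with vanishing intermediate Hasse–Schmidt derivatives is a power
of the exponential characteristic**: on a monomial `x_i^d` of `g`, `D_{a e_i} g` has coefficient
`binom(d, a) coeff(g) ≠ 0` at `x_i^{d−a}` for the Kummer–Lucas exponent `a`. [cite: Schober2021IdealisticExponents, Rem. 2.6] -/
theorem exists_pow_eq_of_hasseDeriv_eq_zero (p : ℕ) [ExpChar K p] {g : MvPolynomial σ K} {d : ℕ}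
    (hg : g.IsHomogeneous d) (hd : 1 ≤ d) (hg0 : g ≠ 0)
    (hD : ∀ A : σ →₀ ℕ, A ≠ 0 → A.degree < d → hasseDeriv K A g = 0) : ∃ e : ℕ, d = p ^ e := by
  by_contra hne
  push Not at hne
  obtain ⟨a, ha0, had, ha⟩ := exists_choose_natCast_ne_zero_of_ne_pow' (K := K) p hd hne
  obtain ⟨B, hB⟩ := support_nonempty.mpr hg0
  obtain ⟨i, rfl⟩ := eq_single_of_mem_support hg hd hD hB
  have hzero := hD (Finsupp.single i a) (by rw [Ne, Finsupp.single_eq_zero]; omega)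
    (by rwa [Finsupp.degree_single])
  have hle : Finsupp.single i a ≤ Finsupp.single i d := by
    refine Finsupp.le_def.mpr fun j => ?_
    by_cases hj : j = i
    · subst hj; rw [Finsupp.single_eq_same, Finsupp.single_eq_same]; omega
    · rw [Finsupp.single_eq_of_ne hj]; exact Nat.zero_le _
  have h := coeff_sub_hasseDeriv hle g
  rw [hzero, coeff_zero, Finsupp.support_single _ (by omega : a ≠ 0), Finset.prod_singleton,
    Finsupp.single_eq_same, Finsupp.single_eq_same] at h
  exact mul_ne_zero ha (mem_support_iff.mp hB) h.symm

/-- **Structure theorem**: over a field of exponential characteristic `p`, a nonzero form `g` of degree `d ≥ 1` whose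
Hasse–Schmidt derivatives `D_A g`, `0 < |A| < d`, vanish is a `p`-FORM `Σ_i c_i x_i^{p^e}` with `d = p^e` (finitely
many variables). [cite: Schober2021IdealisticExponents, Rem. 2.6] [cite: BerthomieuHivertMourtada2010, Def. 1.2] -/
theorem exists_eq_sum_C_mul_X_pow_of_hasseDeriv_eq_zero [Fintype σ] (p : ℕ) [ExpChar K p] {g : MvPolynomial σ K}
    {d : ℕ} (hg : g.IsHomogeneous d) (hd : 1 ≤ d) (hg0 : g ≠ 0)
    (hD : ∀ A : σ →₀ ℕ, A ≠ 0 → A.degree < d → hasseDeriv K A g = 0) :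
    ∃ (e : ℕ) (c : σ → K), d = p ^ e ∧ g = ∑ i, C (c i) * X i ^ p ^ e := by
  obtain ⟨e, he⟩ := exists_pow_eq_of_hasseDeriv_eq_zero p hg hd hg0 hD
  refine ⟨e, fun i => coeff (Finsupp.single i d) g, he, ?_⟩
  rw [← he]
  ext B
  rw [coeff_sum]
  simp_rw [coeff_C_mul, coeff_X_pow]
  by_cases hB : ∃ i, B = Finsupp.single i d
  · obtain ⟨i, rfl⟩ := hB
    rw [Finset.sum_eq_single i]
    · rw [if_pos rfl, mul_one]
    · intro j _ hji
      rw [if_neg, mul_zero]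
      intro h
      exact hji (Finsupp.single_left_injective (by omega : d ≠ 0) h)
    · intro h; exact absurd (Finset.mem_univ i) h
  · push Not at hB
    rw [Finset.sum_eq_zero fun i _ => by rw [if_neg (fun h => hB i h.symm), mul_zero]]
    by_contra hne
    obtain ⟨i, hi⟩ := eq_single_of_mem_support hg hd hD (mem_support_iff.mpr hne)
    exact hB i hi

end Degree

/-! ## 3. Additive forms -/

section Additive

variable {K : Type u} [Field K] {n : ℕ}

/-- The iterated-polynomial reading of `K[X ⊔ Y]`: `X_j ↦ u_j` (outer), `Y_j ↦ x_j` (inner constants), so that the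
co-addition `Δ f = f(X + Y)` becomes the Taylor morphism `f(x + u)`. [cite: BerthomieuHivertMourtada2010, §2.1] -/
private theorem sumAlgEquiv_comul (f : MvPolynomial (Fin n) K) :
    sumAlgEquiv K (Fin n) (Fin n) (comul K n f) = taylor K f := by
  induction f using MvPolynomial.induction_on with
  | C a => rw [comul, aeval_C, MvPolynomial.algebraMap_eq, sumAlgEquiv_C_inl, taylor_C]
  | add p q hp hq => rw [map_add, map_add, hp, hq, map_add]
  | mul_X p j hp =>
    rw [map_mul, map_mul, hp, comul_X, map_add, sumAlgEquiv_X_inl, sumAlgEquiv_X_inr, map_mul, taylor_X, add_comm]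

/-- `f(X)` read in the outer variables: `f(u)`. [cite: BerthomieuHivertMourtada2010, §2.1] -/
private theorem sumAlgEquiv_rename_inl (f : MvPolynomial (Fin n) K) :
    sumAlgEquiv K (Fin n) (Fin n) (rename Sum.inl f) =
      MvPolynomial.map (C : K →+* MvPolynomial (Fin n) K) f := by
  induction f using MvPolynomial.induction_on with
  | C a => rw [rename_C, sumAlgEquiv_C_inl, map_C]
  | add p q hp hq => rw [map_add, map_add, hp, hq, map_add]
  | mul_X p j hp => rw [map_mul, map_mul, hp, rename_X, sumAlgEquiv_X_inl, map_mul, map_X]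

/-- `f(Y)` read in the inner variables: the constant `f(x)`. [cite: BerthomieuHivertMourtada2010, §2.1] -/
private theorem sumAlgEquiv_rename_inr (f : MvPolynomial (Fin n) K) :
    sumAlgEquiv K (Fin n) (Fin n) (rename Sum.inr f) = C f := by
  induction f using MvPolynomial.induction_on with
  | C a => rw [rename_C, sumAlgEquiv_C_inl]
  | add p q hp hq => rw [map_add, map_add, hp, hq, map_add]
  | mul_X p j hp => rw [map_mul, map_mul, hp, rename_X, sumAlgEquiv_X_inr, map_mul]

/-- **An additive polynomial has Taylor expansion `f(x + u) = f(x) + f(u)`** (the definition `Δ f = f ⊗ 1 + 1 ⊗ f`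
read through `K[X ⊔ Y] ≅ K[x][u]`). [cite: BerthomieuHivertMourtada2010, Def. 1.2] -/
theorem IsAdditive.taylor_eq {f : MvPolynomial (Fin n) K} (hf : IsAdditive f) :
    taylor K f = C f + MvPolynomial.map (C : K →+* MvPolynomial (Fin n) K) f := by
  have h := congrArg (sumAlgEquiv K (Fin n) (Fin n)) hf
  rw [sumAlgEquiv_comul, map_add, sumAlgEquiv_rename_inl, sumAlgEquiv_rename_inr] at h
  rw [h, add_comm]

/-- **The Hasse–Schmidt derivatives of an additive polynomial are constants**: `D_A f = coeff_A(f)` for `A ≠ 0`.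
[cite: BerthomieuHivertMourtada2010, Def. 1.2] -/
theorem IsAdditive.hasseDeriv_eq_C {f : MvPolynomial (Fin n) K} (hf : IsAdditive f) {A : Fin n →₀ ℕ} (hA : A ≠ 0) :
    hasseDeriv K A f = C (coeff A f) := by
  rw [hasseDeriv_apply, hf.taylor_eq, coeff_add, coeff_C, if_neg (Ne.symm hA), zero_add, coeff_map]

/-- **Schober's Remark 2.6 / BHM Def. 1.2: a nonzero additive FORM of degree `d ≥ 1` over a field of exponential
characteristic `p` is `Σ_i c_i X_i^{p^e}` with `d = p^e`** (in characteristic `0`, `p = 1`: a linear form).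
[cite: Schober2021IdealisticExponents, Rem. 2.6] -/
theorem IsAdditive.exists_eq_sum_C_mul_X_pow (p : ℕ) [ExpChar K p] {f : MvPolynomial (Fin n) K} (hf : IsAdditive f)
    {d : ℕ} (hfd : f.IsHomogeneous d) (hd : 1 ≤ d) (hf0 : f ≠ 0) :
    ∃ (e : ℕ) (c : Fin n → K), d = p ^ e ∧ f = ∑ i, C (c i) * X i ^ p ^ e := by
  classical
  refine exists_eq_sum_C_mul_X_pow_of_hasseDeriv_eq_zero p hfd hd hf0 fun A hA hAd => ?_
  rw [hf.hasseDeriv_eq_C hA, hfd.coeff_eq_zero hAd.ne, C_0]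

end Additive

end Literature.AlgebraicGeometry.Resolution

end
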